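import Summits.Ventures.Crystal3D.Theorems.StickyWulffConstantPolycrystalWulffBoundTopTwoWulffRows
import Summits.Ventures.Crystal3D.Theorems.StickyWulffConstantPolycrystalWulffBoundTopTwoCutRows
import Summits.Ventures.Crystal3D.Theorems.StickyWulffConstantPolycrystalWulffBoundTopTwoArith
import Summits.Ventures.Crystal3D.Theorems.StickyWulffConstantPolycrystalWulffBoundRungTwinFreeTwoClassesOne

/-!
# `PolycrystalWulffBound`, line `PolyDensity`: the ALL-LATTICES twin-free rung AT THE CRUX'S OWN CHARGE
# `c₀ = 1`, UNCONDITIONALLY — any number of lattice classes, no certificate, no named fact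
# (crux `stmt-Ventures-19482`; lane poly-p2, gen 24)

Route `StickyWulffConstant` of the venture `Summits/Ventures/Crystal3D`, second prover lane.  Until this
file the all-generic (twin-free) class of the v4 crux with ARBITRARILY MANY lattice classes was a kernel
theorem at the crux's charge only modulo CH-P1′ (`WulffOverlap27_8`, kit certificate) AND the
kernel-evaluated LP certificate `AggCert27_8` (`native_decide`, poly-p2 g7), or certificate-free from
charge `3/2` (`rung_twinFree_allClasses_three_halves`, g23).  Here it becomes a plain theorem:

* `rung_twinFree_allClasses_one` : **every twin-free polyhedral crux texture (grains drawn from any number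
  of pairwise non-co-axial lattices, generic walls charged `≥ 1` by the texture clause) satisfies the
  polycrystal Wulff bound `6·2^{1/3}(√2·Vol)^{2/3} ≤ En`** — std axioms, no `native_decide`, no named fact.

PROOF (k-independent «top two classes + dust» LP).  Let `C₁` be a lattice class of largest volume `v₁`.
If `v₁ ≥ (17/20)·Vol`: `rung_dominantTwinFree` (g3).  Else let `C₂` be a class of largest volume `v₂`
among the others and `R` the rest (all its classes have volume `≤ v₂`).  Rows (`…TopTwoWulffRows`,
`…TopTwoCutRows`): energy split with all cross-class walls; per-class Wulff for `C₁`, `C₂`; DUST — the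
per-class Wulff bounds summed over `R` give `Σ_{ℓ⊆R} w(v_ℓ) ≥ w·v_R·v₂^{-1/3}` (`dust_sum_lower`: small
classes are expensive); inradius; BALL CUT on `C₁` (`W₁ ∩ B̄(0,2)`, `9.33·Vol^{2/3}`); TWO-BODY BALL CUT
(`W₁ ∩ W₂ ∩ B̄(0,2)`, `|·| ≥ 26.61`, charged `2` on `R`); isoperimetry of `C₁ ∪ C₂`.  The resulting LP in
the volume fractions `(u₁, u₂) ∈ [0, 0.85] × [0, 0.5]` closes on 13 tiles (`topTwo_arith`, chords of
`u^{2/3}`, min margin `0.24 %`), `topTwo_homog` normalises.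

LADDER of the all-generic class after this file: **`c₀ = 1` (the crux text), ANY number of lattices,
certificate-free** (two lattices: `rung_twinFree_twoClasses_one`, this gen).  Necessary `c₀ ≥ √5 − √3`
(paper).  CH-P1 / CH-P1′ / `AggCert27_8` are no longer load-bearing anywhere on the generic column.
WHAT THIS IS NOT: anything about twins (co-axial pairs of distinct lattices) or V5's `13/25`; the crux
(which allows twins at charge `½`) is not claimed.
-/

noncomputable section

open scoped BigOperators InnerProductSpace ENNReal
open MeasureTheory Filter Finset

namespace Summit.Ventures.Crystal3D.Cruxes.PolycrystalWulffBound.PolyDensity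

open Summit.Ventures.Crystal3D.Theorems
open Summit.Ventures.Crystal3D.Cruxes.TextureLiminf.TexShadow (per polytope E3)
open Literature.MathematicalPhysics.StatisticalMechanics (perimeter)

set_option maxHeartbeats 800000 in
/-- **Twin-free polyhedral crux textures with ANY number of lattice classes satisfy the polycrystal Wulff
bound — at the crux's own wall law, unconditionally.**  See the module docstring. -/
theorem rung_twinFree_allClasses_one :
    let Λ : Set (EuclideanSpace ℝ (Fin 3)) := Literature.MathematicalPhysics.StatisticalMechanics.fccStacking 1 (Real.sqrt (2 / 3));
    let Brl : (ℤ → ℤ) → Set (EuclideanSpace ℝ (Fin 3)) := Literature.MathematicalPhysics.StatisticalMechanics.barlowStacking 1 (Real.sqrt (2 / 3));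
    let Ax : EuclideanSpace ℝ (Fin 3) → (EuclideanSpace ℝ (Fin 3) ≃ₗᵢ[ℝ] EuclideanSpace ℝ (Fin 3)) → (EuclideanSpace ℝ (Fin 3) ≃ₗᵢ[ℝ] EuclideanSpace ℝ (Fin 3)) → Prop := fun m A B => ∃ (L : EuclideanSpace ℝ (Fin 3) ≃ₗᵢ[ℝ] EuclideanSpace ℝ (Fin 3)) (s₁ s₂ : EuclideanSpace ℝ (Fin 3)) (σ σ' : ℤ → ℤ), Literature.MathematicalPhysics.StatisticalMechanics.IsHaggSeq σ ∧ Literature.MathematicalPhysics.StatisticalMechanics.IsHaggSeq σ' ∧ L (EuclideanSpace.single (2 : Fin 3) (1 : ℝ)) = m ∧ A '' Λ ⊆ (fun q => L q + s₁) '' Brl σ ∧ B '' Λ ⊆ (fun q => L q + s₂) '' Brl σ';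
    let CoAx : (EuclideanSpace ℝ (Fin 3) ≃ₗᵢ[ℝ] EuclideanSpace ℝ (Fin 3)) → (EuclideanSpace ℝ (Fin 3) ≃ₗᵢ[ℝ] EuclideanSpace ℝ (Fin 3)) → Prop := fun A B => ∃ m, Ax m A B;
    let Φ : EuclideanSpace ℝ (Fin 3) → ℝ := fun ν => Real.sqrt 2 / 4 * ∑ᶠ w ∈ {w ∈ Λ | ‖w‖ = 1}, |⟪w, ν⟫_ℝ|;
    let Per : Set (EuclideanSpace ℝ (Fin 3)) → Set (EuclideanSpace ℝ (Fin 3)) → ℝ := fun K S => (⨆ (ξ : EuclideanSpace ℝ (Fin 3) → EuclideanSpace ℝ (Fin 3)) (_ : ContDiff ℝ 1 ξ ∧ HasCompactSupport ξ ∧ ∀ z, ξ z ∈ K), ENNReal.ofReal (∫ z in S, Literature.MathematicalPhysics.StatisticalMechanics.fieldDivergence ξ z)).toReal;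
    let ι : Set (EuclideanSpace ℝ (Fin 3)) → Set (EuclideanSpace ℝ (Fin 3)) → Set (EuclideanSpace ℝ (Fin 3)) → ℝ := fun K S₁ S₂ => (Per K S₁ + Per K S₂ - Per K (S₁ ∪ S₂)) / 2;
    let W : (EuclideanSpace ℝ (Fin 3) ≃ₗᵢ[ℝ] EuclideanSpace ℝ (Fin 3)) → Set (EuclideanSpace ℝ (Fin 3)) := fun A => {y | ∀ ν : EuclideanSpace ℝ (Fin 3), ⟪y, ν⟫_ℝ ≤ Φ (A.symm ν)};
    let Dsc : EuclideanSpace ℝ (Fin 3) → Set (EuclideanSpace ℝ (Fin 3)) := fun m => {y | ‖y‖ ≤ 1 ∧ ⟪y, m⟫_ℝ = 0};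
    let Tex : (n : ℕ) → (Fin n → Set (EuclideanSpace ℝ (Fin 3))) → (Fin n → (EuclideanSpace ℝ (Fin 3) ≃ₗᵢ[ℝ] EuclideanSpace ℝ (Fin 3))) → (Fin n → Fin n → ℝ) → (Fin n → Fin n → EuclideanSpace ℝ (Fin 3)) → Prop := fun n G A c m => (∀ f : Fin n, Literature.MathematicalPhysics.StatisticalMechanics.HasFinitePerimeter (G f) ∧ volume (G f) < ⊤) ∧ (∀ f g, f ≠ g → Disjoint (G f) (G g)) ∧ (∀ f g, f ≠ g → 0 ≤ c f g) ∧ (∀ f g, f ≠ g → ¬ CoAx (A f) (A g) → m f g = 0 ∧ 1 ≤ c f g) ∧ (∀ f g, f ≠ g → CoAx (A f) (A g) → A f '' Λ ≠ A g '' Λ → Ax (m f g) (A f) (A g) ∧ 1 / 2 ≤ c f g);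
    let En : (n : ℕ) → (Fin n → Set (EuclideanSpace ℝ (Fin 3))) → (Fin n → (EuclideanSpace ℝ (Fin 3) ≃ₗᵢ[ℝ] EuclideanSpace ℝ (Fin 3))) → (Fin n → Fin n → ℝ) → (Fin n → Fin n → EuclideanSpace ℝ (Fin 3)) → ℝ := fun n G A c m => ∑ f : Fin n, Per (W (A f)) (G f) - ∑ f, ∑ g, (if f = g then 0 else ι (W (A f)) (G f) (G g)) + ∑ f, ∑ g, (if f = g then 0 else c f g / 2 * ι (Dsc (m f g)) (G f) (G g));
    let Vol : (n : ℕ) → (Fin n → Set (EuclideanSpace ℝ (Fin 3))) → ℝ := fun n G => (volume (⋃ f : Fin n, G f)).toReal;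
    let Poly : Set (EuclideanSpace ℝ (Fin 3)) → Prop := fun S => ∃ (k : ℕ) (H : Fin k → Finset ((EuclideanSpace ℝ (Fin 3)) × ℝ)), S = ⋃ i, ⋂ p ∈ H i, {x | ⟪p.1, x⟫_ℝ < p.2};
    let TF : (n : ℕ) → (Fin n → (EuclideanSpace ℝ (Fin 3) ≃ₗᵢ[ℝ] EuclideanSpace ℝ (Fin 3))) → Prop := fun n A => ∀ f g : Fin n, f ≠ g → CoAx (A f) (A g) → A f '' Λ = A g '' Λ;
    ∀ (n : ℕ) (G : Fin n → Set (EuclideanSpace ℝ (Fin 3))) (A : Fin n → (EuclideanSpace ℝ (Fin 3) ≃ₗᵢ[ℝ] EuclideanSpace ℝ (Fin 3))) (c : Fin n → Fin n → ℝ) (m : Fin n → Fin n → EuclideanSpace ℝ (Fin 3)), Tex n G A c m → (∀ f, Poly (G f)) → TF n A → 6 * (2 : ℝ) ^ ((1 : ℝ) / 3) * (Real.sqrt 2 * Vol n G) ^ ((2 : ℝ) / 3) ≤ En n G A c m := by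
  intro Λ Brl Ax CoAx Φ Per ι W Dsc Tex En Vol Poly TF n G A c m hTex hPoly hTF
  have hCh : ∀ f g : Fin n, f ≠ g → ¬ CoAx (A f) (A g) → (1 : ℝ) ≤ c f g :=
    fun f g hfg hnc => (hTex.2.2.2.1 f g hfg hnc).2
  by_cases hdom : ∃ f₀ : Fin n, 17 / 20 * Vol n G ≤ (volume (⋃ g ∈ {g : Fin n | A g '' Λ = A f₀ '' Λ}, G g)).toReal
  · exact rung_dominantTwinFree n G A c m hTex hPoly hTF hdom
  classical
  obtain ⟨hfin, hdisj, -, -, -⟩ := id hTex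
  have hVnn : 0 ≤ Vol n G := ENNReal.toReal_nonneg
  -- lattice classes and their volumes
  set lat : Fin n → Set E3 := fun f => A f '' Λ with hlat
  set v : Set E3 → ℝ := fun ℓ =>
    (volume (⋃ f ∈ Finset.univ.filter (fun f => lat f = ℓ), G f)).toReal with hv
  have hv0 : ∀ ℓ, 0 ≤ v ℓ := fun ℓ => ENNReal.toReal_nonneg
  have hset : ∀ f₀, (⋃ f ∈ Finset.univ.filter (fun f => lat f = lat f₀), G f) =
      ⋃ g ∈ {g : Fin n | A g '' Λ = A f₀ '' Λ}, G g := by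
    intro f₀
    ext x
    simp only [Set.mem_iUnion, Finset.mem_filter, Finset.mem_univ, true_and, Set.mem_setOf_eq,
      exists_prop, hlat]
  have hlt : ∀ f₀, v (lat f₀) < 17 / 20 * Vol n G := by
    intro f₀
    by_contra h
    exact hdom ⟨f₀, by rw [← hset f₀]; exact not_lt.1 h⟩
  -- no grains: trivial
  rcases isEmpty_or_nonempty (Fin n) with hn | hne
  · have hV0 : Vol n G = 0 := by
      show (volume (⋃ f : Fin n, G f)).toReal = 0
      rw [Set.iUnion_of_empty]; simp
    have hE0 : En n G A c m = 0 := by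
      show (∑ f, Per (W (A f)) (G f) - ∑ f, ∑ g, (if f = g then 0 else ι (W (A f)) (G f) (G g)) +
        ∑ f, ∑ g, (if f = g then 0 else c f g / 2 * ι (Dsc (m f g)) (G f) (G g))) = 0
      simp [Finset.univ_eq_empty]
    rw [hV0, hE0, mul_zero, Real.zero_rpow (by norm_num), mul_zero]
  -- the largest class `C₁ ∋ f₁`
  obtain ⟨f₁, -, hmax₁⟩ := Finset.exists_max_image Finset.univ (fun f => v (lat f)) Finset.univ_nonempty
  have hmax₁' : ∀ f, v (lat f) ≤ v (lat f₁) := fun f => hmax₁ f (Finset.mem_univ f)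
  -- a second class exists (else `C₁` carries everything)
  have hVsum : Vol n G = ∑ f, (volume (G f)).toReal := (texture_union_facts G hfin hdisj).2.2.2
  have hvolI : ∀ I : Finset (Fin n), (volume (⋃ f ∈ I, G f)).toReal = ∑ f ∈ I, (volume (G f)).toReal :=
    fun I => (subfamily_union_facts G hfin hdisj I).2.2.2
  set S : Finset (Fin n) := Finset.univ.filter (fun f => lat f ≠ lat f₁) with hS
  have hSne : S.Nonempty := by
    by_contra hS0
    rw [Finset.not_nonempty_iff_eq_empty] at hS0
    have hall : ∀ f, lat f = lat f₁ := by
      intro f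
      by_contra h
      have : f ∈ S := Finset.mem_filter.2 ⟨Finset.mem_univ f, h⟩
      rw [hS0] at this
      exact absurd this (Finset.notMem_empty f)
    have hC : Finset.univ.filter (fun f => lat f = lat f₁) = Finset.univ := by
      ext f; simp [hall f]
    have hV1 : v (lat f₁) = Vol n G := by
      show (volume (⋃ f ∈ Finset.univ.filter (fun f => lat f = lat f₁), G f)).toReal = _
      rw [hvolI, hC, ← hVsum]
    have := hlt f₁
    rw [hV1] at this
    linarith
  obtain ⟨f₂, hf₂S, hmax₂⟩ := Finset.exists_max_image S (fun f => v (lat f)) hSne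
  have hne : lat f₂ ≠ lat f₁ := (Finset.mem_filter.1 hf₂S).2
  have hmax₂' : ∀ f, lat f ≠ lat f₁ → v (lat f) ≤ v (lat f₂) :=
    fun f hf => hmax₂ f (Finset.mem_filter.2 ⟨Finset.mem_univ f, hf⟩)
  -- the rows
  obtain ⟨hα, hβ1, hβ2, hβR, hVR, hVol, hU⟩ :=
    twinFree_topTwo_wulffRows 1 n G A c m f₁ f₂ hTex hPoly hTF zero_le_one hCh hne
  obtain ⟨hδ, hw0, hε1, hε12, hiso⟩ := twinFree_topTwo_cutRows n G A c m f₁ f₂ hTex hPoly hne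
  -- blocks and block variables
  set C₁ : Finset (Fin n) := Finset.univ.filter (fun f => lat f = lat f₁) with hC₁
  set C₂ : Finset (Fin n) := Finset.univ.filter (fun f => lat f = lat f₂) with hC₂
  set R : Finset (Fin n) := Finset.univ \ (C₁ ∪ C₂) with hR
  have hmem₁ : ∀ f, f ∈ C₁ ↔ lat f = lat f₁ := fun f => by simp [hC₁]
  have hmem₂ : ∀ f, f ∈ C₂ ↔ lat f = lat f₂ := fun f => by simp [hC₂]
  have h12 : ∀ f, f ∈ C₁ → f ∉ C₂ := fun f h1 h2 => hne (((hmem₂ f).1 h2).symm.trans ((hmem₁ f).1 h1))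
  have hmemR : ∀ f, f ∈ R ↔ f ∉ C₁ ∧ f ∉ C₂ := fun f => by simp [hR]
  have hdisj12 : Disjoint C₁ C₂ := Finset.disjoint_left.2 fun f h1 h2 => h12 f h1 h2
  have hdisj2R : Disjoint C₂ R := Finset.disjoint_left.2 fun f h2 hr => ((hmemR f).1 hr).2 h2
  have hR₁ : Finset.univ \ C₁ = C₂ ∪ R := by
    ext f
    simp only [Finset.mem_sdiff, Finset.mem_univ, true_and, Finset.mem_union, hmemR]
    constructor
    · intro hf
      by_cases h2 : f ∈ C₂
      · exact Or.inl h2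
      · exact Or.inr ⟨hf, h2⟩
    · rintro (h2 | ⟨h1, -⟩)
      · exact fun h1 => h12 f h1 h2
      · exact h1
  have hsplit3 : ∀ F : Fin n → ℝ, (∑ f, F f) = (∑ f ∈ C₁, F f) + (∑ f ∈ C₂, F f) + ∑ f ∈ R, F f := by
    intro F
    rw [← Finset.sum_sdiff (Finset.subset_univ C₁), hR₁, Finset.sum_union hdisj2R]
    ring
  set FrW : Fin n → ℝ := fun f => Per (W (A f)) (G f) - ∑ g, (if f = g then 0 else ι (W (A f)) (G f) (G g)) with hFrW
  set Yf : Fin n → ℝ := fun f => Per (Metric.closedBall (0 : EuclideanSpace ℝ (Fin 3)) 1) (G f) -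
    ∑ g, (if f = g then 0 else ι (Metric.closedBall (0 : EuclideanSpace ℝ (Fin 3)) 1) (G f) (G g)) with hYf
  set wι : Fin n → Fin n → ℝ := fun f g =>
    (if f = g then 0 else ι (Metric.closedBall (0 : EuclideanSpace ℝ (Fin 3)) 1) (G f) (G g)) with hwι
  set F1 : ℝ := ∑ f ∈ C₁, FrW f with hF1
  set F2 : ℝ := ∑ f ∈ C₂, FrW f with hF2
  set FR : ℝ := ∑ f ∈ R, FrW f with hFR
  set Y1 : ℝ := ∑ f ∈ C₁, Yf f with hY1
  set Y2 : ℝ := ∑ f ∈ C₂, Yf f with hY2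
  set YR : ℝ := ∑ f ∈ R, Yf f with hYR
  set A12 : ℝ := ∑ f ∈ C₁, ∑ g ∈ C₂, wι f g with hA12
  set A1R : ℝ := ∑ f ∈ C₁, ∑ g ∈ R, wι f g with hA1R
  set A2R : ℝ := ∑ f ∈ C₂, ∑ g ∈ R, wι f g with hA2R
  set WRR : ℝ := ∑ f ∈ R, ∑ g ∈ R, (if lat g = lat f then 0 else wι f g) with hWRR
  set v1 : ℝ := v (lat f₁) with hv1
  set v2 : ℝ := v (lat f₂) with hv2
  set vR : ℝ := (volume (⋃ f ∈ R, G f)).toReal with hvR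
  -- the rows in block variables
  have hα' : (∑ f, FrW f) + 1 * (A12 + A1R + A2R) + 1 / 2 * WRR ≤ En n G A c m := hα
  have hβ1' : 6 * (2 : ℝ) ^ ((1 : ℝ) / 3) * (Real.sqrt 2 * v1) ^ ((2 : ℝ) / 3) ≤ F1 + Real.sqrt 5 * (A12 + A1R) := hβ1
  have hβ2' : 6 * (2 : ℝ) ^ ((1 : ℝ) / 3) * (Real.sqrt 2 * v2) ^ ((2 : ℝ) / 3) ≤ F2 + Real.sqrt 5 * (A12 + A2R) := hβ2
  have hβR' : (∑ ℓ ∈ R.image lat, 6 * (2 : ℝ) ^ ((1 : ℝ) / 3) * (Real.sqrt 2 * v ℓ) ^ ((2 : ℝ) / 3)) ≤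
      FR + Real.sqrt 5 * (A1R + A2R + WRR) := hβR
  have hVR' : (∑ ℓ ∈ R.image lat, v ℓ) = vR := hVR
  have hVol' : Vol n G = v1 + v2 + vR := hVol
  have hU' : (∑ f ∈ C₁ ∪ C₂, ∑ g ∈ R, wι f g) = A1R + A2R := hU
  have hδ' : ∀ f, 0 ≤ Yf f ∧ Real.sqrt 3 * Yf f ≤ FrW f := hδ
  have hw0' : ∀ f g, 0 ≤ wι f g := hw0
  have hε1' : 3 * (Real.pi * (24 * Real.sqrt 3 - 32)) ^ ((1 : ℝ) / 3) * (Vol n G) ^ ((2 : ℝ) / 3) ≤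
      F1 + 2 * ∑ f ∈ Finset.univ \ C₁, Yf f := hε1
  have hε12' : 3 * (26.61 : ℝ) ^ ((1 : ℝ) / 3) * (Vol n G) ^ ((2 : ℝ) / 3) ≤ F1 + F2 + 2 * YR := hε12
  have hiso' : 3 * (Real.pi * 4 / 3) ^ ((1 : ℝ) / 3) * (volume (⋃ f ∈ C₁ ∪ C₂, G f)).toReal ^ ((2 : ℝ) / 3) ≤
      (∑ f ∈ C₁ ∪ C₂, Yf f) + ∑ f ∈ C₁ ∪ C₂, ∑ g ∈ R, wι f g := hiso
  -- bookkeeping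
  have hsplitF : (∑ f, FrW f) = F1 + F2 + FR := hsplit3 FrW
  have hYrest : (∑ f ∈ Finset.univ \ C₁, Yf f) = Y2 + YR := by rw [hR₁, Finset.sum_union hdisj2R]
  have hY12 : (∑ f ∈ C₁ ∪ C₂, Yf f) = Y1 + Y2 := Finset.sum_union hdisj12
  have hvol12 : (volume (⋃ f ∈ C₁ ∪ C₂, G f)).toReal = v1 + v2 := by
    rw [hvolI, Finset.sum_union hdisj12]
    show _ = (volume (⋃ f ∈ Finset.univ.filter (fun f => lat f = lat f₁), G f)).toReal +
      (volume (⋃ f ∈ Finset.univ.filter (fun f => lat f = lat f₂), G f)).toReal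
    rw [hvolI, hvolI]
  -- signs
  have hY10 : 0 ≤ Y1 := Finset.sum_nonneg fun f _ => (hδ' f).1
  have hY20 : 0 ≤ Y2 := Finset.sum_nonneg fun f _ => (hδ' f).1
  have hYR0 : 0 ≤ YR := Finset.sum_nonneg fun f _ => (hδ' f).1
  have hA120 : 0 ≤ A12 := Finset.sum_nonneg fun f _ => Finset.sum_nonneg fun g _ => hw0' f g
  have hA1R0 : 0 ≤ A1R := Finset.sum_nonneg fun f _ => Finset.sum_nonneg fun g _ => hw0' f g
  have hA2R0 : 0 ≤ A2R := Finset.sum_nonneg fun f _ => Finset.sum_nonneg fun g _ => hw0' f g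
  have hWRR0 : 0 ≤ WRR := Finset.sum_nonneg fun f _ => Finset.sum_nonneg fun g _ => by
    split_ifs
    · exact le_rfl
    · exact hw0' f g
  have hδ1 : Real.sqrt 3 * Y1 ≤ F1 := by
    rw [hY1, Finset.mul_sum]; exact Finset.sum_le_sum fun f _ => (hδ' f).2
  have hδ2 : Real.sqrt 3 * Y2 ≤ F2 := by
    rw [hY2, Finset.mul_sum]; exact Finset.sum_le_sum fun f _ => (hδ' f).2
  have hδR : Real.sqrt 3 * YR ≤ FR := by
    rw [hYR, Finset.mul_sum]; exact Finset.sum_le_sum fun f _ => (hδ' f).2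
  -- volume ordering
  have h21 : v2 ≤ v1 := hmax₁' f₂
  have h85 : v1 ≤ 17 / 20 * Vol n G := le_of_lt (hlt f₁)
  have hvR0 : 0 ≤ vR := ENNReal.toReal_nonneg
  -- DUST: every class inside `R` has volume `≤ v2`
  have hdust : ∀ τ d : ℝ, v2 ≤ τ → 0 < τ → 0 ≤ d → d ^ 3 * τ ≤ 1 →
      6 * ((2 : ℝ) ^ ((1 : ℝ) / 3)) ^ 2 * d * vR ≤ FR + Real.sqrt 5 * (A1R + A2R + WRR) := by
    intro τ d hτ2 hτ hd hdτ
    have hvs : ∀ ℓ ∈ R.image lat, 0 ≤ v ℓ ∧ v ℓ ≤ τ := by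
      intro ℓ hℓ
      obtain ⟨g, hgR, rfl⟩ := Finset.mem_image.1 hℓ
      have hg1 : lat g ≠ lat f₁ := fun h => ((hmemR g).1 hgR).1 ((hmem₁ g).2 h)
      exact ⟨hv0 _, (hmax₂' g hg1).trans hτ2⟩
    have h := dust_sum_lower (R.image lat) v hτ hd hdτ hvs
    rw [hVR'] at h
    linarith
  -- assemble
  rw [hsplitF] at hα'
  rw [hYrest] at hε1'
  rw [hY12, hU', hvol12] at hiso'
  exact topTwo_homog hVol' (hv0 _) (hv0 _) hvR0 h21 h85 hY10 hY20 hYR0 hA120 hA1R0 hA2R0 hWRR0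
    hα' hβ1' hβ2' hdust hδ1 hδ2 hδR hε1' hε12' hiso'

end Summit.Ventures.Crystal3D.Cruxes.PolycrystalWulffBound.PolyDensity

end
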